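import Summits.KontsevichZagierPeriods.KontsevichZagierPeriods.Theorems.TerasomaMultiplicationMultiplicationAccessibleCornerYDerivBoundGenAux
import Summits.KontsevichZagierPeriods.KontsevichZagierPeriods.Theorems.TerasomaMultiplicationMultiplicationAccessibleCornerGraphSpellingGen

/-!
# `MultiplicationAccessible` (stmt-KontsevichZagierPeriods-12305), line `shifted-family-prime-sieve`:
the `y`-derivative of the corner Stokes component `V_y` and its uniform bound, dimension `p = n + 2`

Registered stub `cornerYDerivBoundGen` of the general-`p` assembly: the derivative-bound core of the
exceptional-face (`y`-direction) Newton–Leibniz move.  On the open chart domain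
`W = U × (0,1)_v` (`u = (θ₁,…,θ_{n+1}, y) ∈ U`, `Θ₀ = 1 − Σθ_i`, `Θ_{i+1} = θ_i`, box coordinates
`t_k = 1 − yΘ_k ∈ (0,1)`) the component
`V_y = v^{px−1}(1 − vZ)^{ps−1}H^{ps}K·Σ_kΘ_kM_k` (`Z = (∏t)^{1/p}`, `H = (Σ_{j<p}Z^j)/S`,
`yS = 1 − ∏t`, `K = (∏Θ)^{s−1}`, `M_k = t_k^x∏_j t_{k+j+1}^{x+(j+1)/p−1}`, `x ≥ 2`, `s ≥ 3`) has,
along every `y`-slice, a derivative bounded by a constant depending only on `n, x, s`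
(`CornerYDerivBound.fibre`: product and chain rule; the poles `1/t_k` of `∂_yZ` are absorbed by
`Σ_kΘ_kM_k ≤ ∏t_k`, `S ≥ 1/p`, `H ≤ p²`).  Choosing this derivative as `d` gives the stub.
Dimension-`p` version of `cornerStokesYFibreDeriv` / `cornerStokesYAux` (`p = 3`).

References: M. Kontsevich, D. Zagier, *Periods* (2001), §1.2 rule (3).
-/

noncomputable section

open Set Real Finset
open scoped BigOperators

namespace Summit.KontsevichZagierPeriods.TerasomaMultiplication.MultiplicationAccessible

namespace CornerYDerivBound

/-- Derivative of `N = Σ_{j<p} Z^j` along the fibre (chain rule). [folklore] -/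
theorem hasDerivAt_N (n : ℕ) {Zf : ℝ → ℝ} {Zd y : ℝ} (dZ : HasDerivAt Zf Zd y) :
    HasDerivAt (fun a => ∑ j ∈ Finset.range (n + 2), Zf a ^ j)
      ((∑ j ∈ Finset.range (n + 2), (j:ℝ) * Zf y ^ (j - 1)) * Zd) y := by
  have h : ∀ j ∈ Finset.range (n + 2),
      HasDerivAt (fun a => Zf a ^ j) ((j:ℝ) * Zf y ^ (j - 1) * Zd) y := fun j _ => dZ.fun_pow j
  refine (HasDerivAt.fun_sum h).congr_deriv ?_
  rw [Finset.sum_mul]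

/-- Ranges of `N = Σ_{j<p} Z^j ∈ [1, p]` and `N₁ = Σ_{j<p} j Z^{j−1} ∈ [0, p²]` for `Z ∈ [0,1]`.
[folklore] -/
theorem N_mem (n : ℕ) {Z : ℝ} (hZ0 : 0 ≤ Z) (hZ1 : Z ≤ 1) :
    (1 ≤ ∑ j ∈ Finset.range (n + 2), Z ^ j ∧ ∑ j ∈ Finset.range (n + 2), Z ^ j ≤ (n:ℝ) + 2) ∧
    (0 ≤ ∑ j ∈ Finset.range (n + 2), (j:ℝ) * Z ^ (j - 1) ∧
      ∑ j ∈ Finset.range (n + 2), (j:ℝ) * Z ^ (j - 1) ≤ ((n:ℝ) + 2) ^ 2) := by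
  refine ⟨⟨?_, ?_⟩, Finset.sum_nonneg fun j _ => by positivity, ?_⟩
  · rw [Finset.sum_range_succ']
    simp only [pow_zero]
    have : 0 ≤ ∑ j ∈ Finset.range (n + 1), Z ^ (j + 1) :=
      Finset.sum_nonneg fun j _ => by positivity
    linarith
  · calc ∑ j ∈ Finset.range (n + 2), Z ^ j ≤ ∑ _j ∈ Finset.range (n + 2), (1:ℝ) :=
          Finset.sum_le_sum fun j _ => pow_le_one₀ hZ0 hZ1
      _ = (n:ℝ) + 2 := by
          rw [Finset.sum_const, Finset.card_range, nsmul_eq_mul, mul_one]; push_cast; ring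
  · calc ∑ j ∈ Finset.range (n + 2), (j:ℝ) * Z ^ (j - 1)
        ≤ ∑ _j ∈ Finset.range (n + 2), ((n:ℝ) + 2) := Finset.sum_le_sum fun j hj => by
          have hj' : (j:ℝ) ≤ (n:ℝ) + 2 := by exact_mod_cast (Finset.mem_range.1 hj).le
          calc (j:ℝ) * Z ^ (j - 1) ≤ (j:ℝ) * 1 :=
                mul_le_mul_of_nonneg_left (pow_le_one₀ hZ0 hZ1) (by positivity)
            _ ≤ (n:ℝ) + 2 := by linarith
      _ = ((n:ℝ) + 2) ^ 2 := by
          rw [Finset.sum_const, Finset.card_range, nsmul_eq_mul]; push_cast; ring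

/-- **The fibre derivative of `V_y` along `y` and its uniform bound** (dimension `p = n + 2`).  At an
interior point `y` of a `y`-fibre of the chart domain (`θ_k > 0`, `Σθ_k = 1`, `0 < y`, `yθ_k < 1`,
`0 < v < 1`) the fibre function
`F = v^{px−1}(1 − vZ)^{ps−1}((Σ_{j<p}Z^j)/S)^{ps}(∏θ)^{s−1}·Σ_kθ_kM_k` has a derivative bounded by
`(p²)^{ps}·((ps − 1) + ps·p³(1 + (2p)^{p+1}) + px)` (`x ≥ 2`, `s ≥ 3`): product and chain rule,
every factor being bounded once the poles `1/t_k` of `∂_yZ` are absorbed by `Σθ_kM_k ≤ ∏t`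
(`S ≥ 1/p`, `H ≤ p²`, `|∂_y∏t| ≤ 1`, `|∂_yS| ≤ (2p)^{p+1}`, `|∂_yM_k| ≤ px`).
[cite: KontsevichZagier2001, §1.2 rule (3)] -/
theorem fibre {n : ℕ} {x s y v : ℝ} {θ : Fin (n + 2) → ℝ} (hx : 2 ≤ x) (hs : 3 ≤ s)
    (hθ : ∀ k, 0 < θ k) (hsum : ∑ k, θ k = 1) (hy : 0 < y) (hyθ : ∀ k, y * θ k < 1)
    (hv0 : 0 < v) (hv1 : v < 1) (Zf Sf F : ℝ → ℝ) (Mf : Fin (n + 2) → ℝ → ℝ)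
    (hZf : ∀ a, Zf a = (∏ k, (1 - a * θ k)) ^ (1 / ((n:ℝ) + 2)))
    (hSf : ∀ a, Sf a = ∑ j ∈ Finset.range (n + 2), (-1:ℝ) ^ j * a ^ j *
      ∑ A ∈ Finset.powersetCard (j + 1) (Finset.univ : Finset (Fin (n + 2))), ∏ k ∈ A, θ k)
    (hV : y * Sf y = 1 - ∏ k, (1 - y * θ k))
    (hMf : ∀ k a, Mf k a = (1 - a * θ k) ^ x *
      ∏ j : Fin (n + 1), (1 - a * θ (k + j.succ)) ^ (x + (((j:ℕ):ℝ) + 1) / ((n:ℝ) + 2) - 1))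
    (hF : ∀ a, F a = v ^ (((n:ℝ) + 2) * x - 1) * (1 - v * Zf a) ^ (((n:ℝ) + 2) * s - 1) *
      ((∑ j ∈ Finset.range (n + 2), Zf a ^ j) / Sf a) ^ (((n:ℝ) + 2) * s) *
      (∏ k, θ k) ^ (s - 1) * ∑ k, θ k * Mf k a) :
    ∃ D, HasDerivAt F D y ∧ |D| ≤ (((n:ℝ) + 2) ^ 2) ^ (((n:ℝ) + 2) * s) *
      ((((n:ℝ) + 2) * s - 1) +
        ((n:ℝ) + 2) * s * (((n:ℝ) + 2) ^ 3 * (1 + (2 * ((n:ℝ) + 2)) ^ (n + 3))) +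
        ((n:ℝ) + 2) * x) := by
  -- elementary positivity on the fibre
  have hn0 : (0:ℝ) ≤ n := n.cast_nonneg
  have hp0 : (0:ℝ) < (n:ℝ) + 2 := by positivity
  have hp1 : (1:ℝ) ≤ (n:ℝ) + 2 := by linarith
  have hns : (0:ℝ) ≤ (n:ℝ) * s := mul_nonneg hn0 (by linarith)
  have hnx : (0:ℝ) ≤ (n:ℝ) * x := mul_nonneg hn0 (by linarith)
  have hθ0 : ∀ k, 0 ≤ θ k := fun k => (hθ k).le
  have hθ1 : ∀ k, θ k ≤ 1 := fun k =>
    calc θ k ≤ ∑ l, θ l := Finset.single_le_sum (f := θ) (fun l _ => hθ0 l) (Finset.mem_univ k)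
      _ = 1 := hsum
  have ht0 : ∀ k, 0 < 1 - y * θ k := fun k => by linarith [hyθ k]
  have ht1 : ∀ k, 1 - y * θ k ≤ 1 := fun k => by have := mul_pos hy (hθ k); linarith
  have hPT0e : 0 < ∏ k, (1 - y * θ k) := Finset.prod_pos fun k _ => ht0 k
  have hPT1e : ∏ k, (1 - y * θ k) ≤ 1 :=
    Finset.prod_le_one (fun k _ => (ht0 k).le) fun k _ => ht1 k
  have hyp : y ≤ (n:ℝ) + 2 := by
    calc y = ∑ k, y * θ k := by rw [← Finset.mul_sum, hsum, mul_one]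
      _ ≤ ∑ _k : Fin (n + 2), (1:ℝ) := Finset.sum_le_sum fun k _ => (hyθ k).le
      _ = (n:ℝ) + 2 := by
          rw [Finset.sum_const, Finset.card_univ, Fintype.card_fin, nsmul_eq_mul, mul_one]
          push_cast
          ring
  have hSpe : 1 / ((n:ℝ) + 2) ≤ Sf y := inv_le_S hsum hy (fun k => (ht0 k).le) ht1 hV
  have hS0e : 0 < Sf y := lt_of_lt_of_le (by positivity) hSpe
  have hZ0e : 0 < Zf y := by rw [hZf]; exact rpow_pos_of_pos hPT0e _
  have hZ1e : Zf y ≤ 1 := by rw [hZf]; exact rpow_le_one hPT0e.le hPT1e (by positivity)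
  have hG : 0 < 1 - v * Zf y := by
    have := mul_le_mul_of_nonneg_left hZ1e hv0.le; linarith
  have hHqe : 0 < (∑ j ∈ Finset.range (n + 2), Zf y ^ j) / Sf y :=
    div_pos (lt_of_lt_of_le one_pos (N_mem n hZ0e.le hZ1e).1.1) hS0e
  -- the monomials: ranges and derivatives
  have hmono := fun k => monomial hx hθ0 hθ1 ht0 ht1 k (Mf k) (hMf k)
  choose md hmd using fun k => (hmono k).2
  -- the values at `y`, as opaque atoms
  obtain ⟨PT, hPTv⟩ : ∃ e, ∏ k, (1 - y * θ k) = e := ⟨_, rfl⟩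
  obtain ⟨Z, hZv⟩ : ∃ e, Zf y = e := ⟨_, rfl⟩
  obtain ⟨Sv, hSv⟩ : ∃ e, Sf y = e := ⟨_, rfl⟩
  obtain ⟨pd, hpd⟩ : ∃ e, ∑ k, (∏ l ∈ Finset.univ.erase k, (1 - y * θ l)) * (-θ k) = e :=
    ⟨_, rfl⟩
  obtain ⟨Sd, hSd⟩ : ∃ e, ∑ j ∈ Finset.range (n + 2), (-1:ℝ) ^ j * ((j:ℝ) * y ^ (j - 1)) *
      ∑ A ∈ Finset.powersetCard (j + 1) (Finset.univ : Finset (Fin (n + 2))), ∏ k ∈ A, θ k = e :=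
    ⟨_, rfl⟩
  obtain ⟨N, hN⟩ : ∃ e, ∑ j ∈ Finset.range (n + 2), Z ^ j = e := ⟨_, rfl⟩
  obtain ⟨N1, hN1⟩ : ∃ e, ∑ j ∈ Finset.range (n + 2), (j:ℝ) * Z ^ (j - 1) = e := ⟨_, rfl⟩
  obtain ⟨B, hB⟩ : ∃ e, ∑ k, θ k * Mf k y = e := ⟨_, rfl⟩
  obtain ⟨Bd, hBd⟩ : ∃ e, ∑ k, θ k * md k = e := ⟨_, rfl⟩
  obtain ⟨Zd, hZd⟩ : ∃ e, Z * pd / (((n:ℝ) + 2) * PT) = e := ⟨_, rfl⟩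
  obtain ⟨Hd, hHd⟩ : ∃ e, (N1 * Zd * Sv - N * Sd) / Sv ^ 2 = e := ⟨_, rfl⟩
  obtain ⟨E, hE⟩ : ∃ e, v ^ (((n:ℝ) + 2) * x - 1) = e := ⟨_, rfl⟩
  obtain ⟨kK, hk⟩ : ∃ e, (∏ k, θ k) ^ (s - 1) = e := ⟨_, rfl⟩
  obtain ⟨Ga, hGa⟩ : ∃ e, (1 - v * Z) ^ (((n:ℝ) + 2) * s - 1) = e := ⟨_, rfl⟩
  obtain ⟨Gb, hGb⟩ : ∃ e, (1 - v * Z) ^ (((n:ℝ) + 2) * s - 2) = e := ⟨_, rfl⟩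
  obtain ⟨Ha, hHa⟩ : ∃ e, (N / Sv) ^ (((n:ℝ) + 2) * s) = e := ⟨_, rfl⟩
  obtain ⟨Hb, hHb⟩ : ∃ e, (N / Sv) ^ (((n:ℝ) + 2) * s - 1) = e := ⟨_, rfl⟩
  have hPT0 : 0 < PT := hPTv ▸ hPT0e
  have hPT1 : PT ≤ 1 := hPTv ▸ hPT1e
  have hZ0 : 0 < Z := hZv ▸ hZ0e
  have hZ1 : Z ≤ 1 := hZv ▸ hZ1e
  have hSp : 1 / ((n:ℝ) + 2) ≤ Sv := hSv ▸ hSpe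
  have hS0 : 0 < Sv := hSv ▸ hS0e
  have hG' : 0 < 1 - v * Z := hZv ▸ hG
  have hG1 : 1 - v * Z ≤ 1 := by have := mul_pos hv0 hZ0; linarith
  obtain ⟨⟨hNl, hNu⟩, ⟨hN1l, hN1u⟩⟩ := N_mem n hZ0.le hZ1
  rw [hN] at hNl hNu
  rw [hN1] at hN1l hN1u
  have hHq : 0 < N / Sv := div_pos (by linarith) hS0
  -- the calculus
  have dZ : HasDerivAt Zf Zd y := by
    refine (hasDerivAt_Z hPT0e Zf hZf).congr_deriv ?_
    rw [hZv, hpd, hPTv, ← hZd]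
  have dS : HasDerivAt Sf Sd y := (hasDerivAt_S θ y Sf hSf).congr_deriv hSd
  have dN : HasDerivAt (fun a => ∑ j ∈ Finset.range (n + 2), Zf a ^ j) (N1 * Zd) y := by
    refine (hasDerivAt_N n dZ).congr_deriv ?_
    rw [hZv, hN1]
  have dH : HasDerivAt (fun a => (∑ j ∈ Finset.range (n + 2), Zf a ^ j) / Sf a) Hd y := by
    refine (dN.fun_div dS hS0e.ne').congr_deriv ?_
    rw [hZv, hN, hSv, hHd]
  have dHp : HasDerivAt (fun a => ((∑ j ∈ Finset.range (n + 2), Zf a ^ j) / Sf a) ^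
      (((n:ℝ) + 2) * s)) (Hd * (((n:ℝ) + 2) * s) * Hb) y := by
    refine (dH.rpow_const (p := ((n:ℝ) + 2) * s) (Or.inl hHqe.ne')).congr_deriv ?_
    rw [hZv, hN, hSv, hHb]
  have dG : HasDerivAt (fun a => (1 - v * Zf a) ^ (((n:ℝ) + 2) * s - 1))
      (-(v * Zd) * (((n:ℝ) + 2) * s - 1) * Gb) y := by
    refine (((dZ.const_mul v).const_sub 1).rpow_const (p := ((n:ℝ) + 2) * s - 1)
      (Or.inl hG.ne')).congr_deriv ?_
    rw [show ((n:ℝ) + 2) * s - 1 - 1 = ((n:ℝ) + 2) * s - 2 by ring, hZv, hGb]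
  have dB : HasDerivAt (fun a => ∑ k, θ k * Mf k a) Bd y := by
    have h : ∀ k ∈ (Finset.univ : Finset (Fin (n + 2))),
        HasDerivAt (fun a => θ k * Mf k a) (θ k * md k) y := fun k _ => (hmd k).1.const_mul (θ k)
    exact (HasDerivAt.fun_sum h).congr_deriv hBd
  have dP : HasDerivAt (fun a => v ^ (((n:ℝ) + 2) * x - 1) * (1 - v * Zf a) ^ (((n:ℝ) + 2) * s - 1) *
      ((∑ j ∈ Finset.range (n + 2), Zf a ^ j) / Sf a) ^ (((n:ℝ) + 2) * s) * (∏ k, θ k) ^ (s - 1))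
      (E * kK * (-(v * Zd) * (((n:ℝ) + 2) * s - 1) * Gb * Ha +
        Ga * (Hd * (((n:ℝ) + 2) * s) * Hb))) y := by
    refine (((dG.const_mul (v ^ (((n:ℝ) + 2) * x - 1))).fun_mul dHp).mul_const
      ((∏ k, θ k) ^ (s - 1))).congr_deriv ?_
    rw [hZv, hN, hSv, hGa, hHa, hE, hk]; ring
  refine ⟨-(E * kK * (((n:ℝ) + 2) * s - 1) * Gb * v * Ha) * (Zd * B) +
    E * kK * (((n:ℝ) + 2) * s) * Ga * Hb * (Hd * B) + E * Ga * Ha * kK * Bd, ?_, ?_⟩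
  · refine ((dP.fun_mul dB).congr_of_eventuallyEq (Filter.Eventually.of_forall hF)).congr_deriv ?_
    rw [hZv, hN, hSv, hGa, hHa, hE, hk, hB]; ring
  -- the bound: ranges of the atoms
  have hE0 : 0 ≤ E := by rw [← hE]; positivity
  have hE1 : E ≤ 1 := by rw [← hE]; exact rpow_le_one hv0.le hv1.le (by linarith)
  have hθp1 : ∏ k, θ k ≤ 1 := Finset.prod_le_one (fun k _ => hθ0 k) fun k _ => hθ1 k
  have hk0 : 0 ≤ kK := by rw [← hk]; exact rpow_nonneg (Finset.prod_nonneg fun k _ => hθ0 k) _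
  have hk1 : kK ≤ 1 := by
    rw [← hk]; exact rpow_le_one (Finset.prod_nonneg fun k _ => hθ0 k) hθp1 (by linarith)
  have hGa0 : 0 ≤ Ga := by rw [← hGa]; exact rpow_nonneg hG'.le _
  have hGa1 : Ga ≤ 1 := by rw [← hGa]; exact rpow_le_one hG'.le hG1 (by linarith)
  have hGb0 : 0 ≤ Gb := by rw [← hGb]; exact rpow_nonneg hG'.le _
  have hGb1 : Gb ≤ 1 := by rw [← hGb]; exact rpow_le_one hG'.le hG1 (by linarith)
  have hH0 : 0 ≤ N / Sv := hHq.le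
  have hHp2 : N / Sv ≤ ((n:ℝ) + 2) ^ 2 := by
    rw [div_le_iff₀ hS0]
    have hpS : 1 ≤ ((n:ℝ) + 2) * Sv := by rw [div_le_iff₀ hp0] at hSp; linarith
    calc N ≤ ((n:ℝ) + 2) * 1 := by linarith
      _ ≤ ((n:ℝ) + 2) * (((n:ℝ) + 2) * Sv) := mul_le_mul_of_nonneg_left hpS hp0.le
      _ = ((n:ℝ) + 2) ^ 2 * Sv := by ring
  have hp21 : (1:ℝ) ≤ ((n:ℝ) + 2) ^ 2 := one_le_pow₀ hp1
  have hHa0 : 0 ≤ Ha := by rw [← hHa]; positivity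
  have hHaQ : Ha ≤ (((n:ℝ) + 2) ^ 2) ^ (((n:ℝ) + 2) * s) := by
    rw [← hHa]; exact Real.rpow_le_rpow hH0 hHp2 (by linarith)
  have hHb0 : 0 ≤ Hb := by rw [← hHb]; positivity
  have hHbQ : Hb ≤ (((n:ℝ) + 2) ^ 2) ^ (((n:ℝ) + 2) * s) := by
    rw [← hHb]
    exact (Real.rpow_le_rpow hH0 hHp2 (by linarith)).trans
      (Real.rpow_le_rpow_of_exponent_le hp21 (by linarith))
  have hB0 : 0 ≤ B := by
    rw [← hB]; exact Finset.sum_nonneg fun k _ => mul_nonneg (hθ0 k) (hmono k).1.1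
  have hBP : B ≤ PT := by
    rw [← hB, ← hPTv]
    calc ∑ k, θ k * Mf k y ≤ ∑ k, θ k * ∏ l, (1 - y * θ l) :=
          Finset.sum_le_sum fun k _ => mul_le_mul_of_nonneg_left (hmono k).1.2 (hθ0 k)
      _ = ∏ l, (1 - y * θ l) := by rw [← Finset.sum_mul, hsum, one_mul]
  have hpd1 : |pd| ≤ 1 := by
    rw [← hpd]; exact abs_prodT_deriv_le hθ0 hsum (fun k => (ht0 k).le) ht1
  have hSdC : |Sd| ≤ (2 * ((n:ℝ) + 2)) ^ (n + 3) := by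
    rw [← hSd]; exact abs_Sd_le hθ0 hθ1 hy.le hyp
  have hZB : |Zd * B| ≤ 1 := abs_ZB_le hZ0.le hZ1 hpd1 hp1 hPT0 hB0 hBP hZd
  have hHB : |Hd * B| ≤ ((n:ℝ) + 2) ^ 3 * (1 + (2 * ((n:ℝ) + 2)) ^ (n + 3)) :=
    abs_HB_le hp1 hZB hN1l hN1u (by linarith) hNu hSdC hSp hB0 (hBP.trans hPT1) hHd
  have hBdx : |Bd| ≤ ((n:ℝ) + 2) * x := by
    rw [← hBd]
    calc |∑ k, θ k * md k| ≤ ∑ k, |θ k * md k| := Finset.abs_sum_le_sum_abs _ _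
      _ ≤ ∑ k, θ k * (((n:ℝ) + 2) * x) := Finset.sum_le_sum fun k _ => by
          rw [abs_mul, abs_of_nonneg (hθ0 k)]
          exact mul_le_mul_of_nonneg_left (hmd k).2 (hθ0 k)
      _ = ((n:ℝ) + 2) * x := by rw [← Finset.sum_mul, hsum, one_mul]
  exact three_terms_le (by linarith) (by linarith) hv0.le hv1.le hE0 hE1 hk0 hk1 hGa0 hGa1 hGb0
    hGb1 (by positivity) hHa0 hHaQ hHb0 hHbQ hZB hHB hBdx

end CornerYDerivBound

/-- **Registered stub `cornerYDerivBoundGen`** — the derivative-bound core of the `y`-direction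
(exceptional-face) Newton–Leibniz move of the general-`p` corner Stokes (`p = n + 2`): there is a
function `d`, bounded on the open chart domain `W = U × (0,1)_v` by a constant depending only on
`n, x, s`, such that `d w` is the derivative at `y = w_y` of the `y`-slice
`a ↦ V_y(θ, a, v)` of `V_y = P·Σ_kΘ_kM_k`.  Pointwise this slice is the one-variable fibre function
of `CornerYDerivBound.fibre` (only `y` moves: `Θ`, `K`, `v` are constant along the slice,
`T_k = 1 − aΘ_k`), which gives the derivative and the uniform bound; `d` is this derivative.
[cite: KontsevichZagier2001, §1.2 rule (3)] -/
theorem cornerYDerivBoundGen : ∀ (n : ℕ) (x s : ℚ), 2 ≤ x → 3 ≤ s → ∀ (Θ T : (Fin (n + 2) → ℝ) → Fin (n + 2) → ℝ) (Z S H K : (Fin (n + 2) → ℝ) → ℝ)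
      (M : (Fin (n + 2) → ℝ) → Fin (n + 2) → ℝ) (P : (Fin (n + 3) → ℝ) → ℝ),
    (∀ u, Θ u 0 = 1 - ∑ i : Fin (n + 1), u (Fin.castSucc i)) → (∀ u (i : Fin (n + 1)), Θ u i.succ = u (Fin.castSucc i)) →
    (∀ u k, T u k = 1 - u (Fin.last (n + 1)) * Θ u k) →
    (∀ u, Z u = (∏ k, T u k) ^ (1 / ((n:ℝ) + 2))) →
    (∀ u, S u = ∑ j ∈ Finset.range (n + 2), (-1:ℝ) ^ j * u (Fin.last (n + 1)) ^ j *
      ∑ A ∈ Finset.powersetCard (j + 1) (Finset.univ : Finset (Fin (n + 2))), ∏ k ∈ A, Θ u k) →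
    (∀ u, H u = (∑ j ∈ Finset.range (n + 2), Z u ^ j) / S u) →
    (∀ u, K u = (∏ k, Θ u k) ^ ((s:ℝ) - 1)) →
    (∀ u k, M u k = (T u k) ^ (x:ℝ) * ∏ j : Fin (n + 1), (T u (k + j.succ)) ^ ((x:ℝ) + (((j:ℕ):ℝ) + 1) / ((n:ℝ) + 2) - 1)) →
    (∀ w, P w = (w (Fin.last (n + 2))) ^ (((n:ℝ) + 2) * (x:ℝ) - 1) *
      (1 - w (Fin.last (n + 2)) * Z (Fin.init w)) ^ (((n:ℝ) + 2) * (s:ℝ) - 1) * H (Fin.init w) ^ (((n:ℝ) + 2) * (s:ℝ)) * K (Fin.init w)) →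
    ∀ (Vy : (Fin (n + 3) → ℝ) → ℝ), (∀ w, Vy w = P w * ∑ k, Θ (Fin.init w) k * M (Fin.init w) k) →
    ∃ d : (Fin (n + 3) → ℝ) → ℝ, (∃ C : ℝ, ∀ w ∈ {w : Fin (n + 3) → ℝ | (Fin.init w : Fin (n + 2) → ℝ) ∈ {u : Fin (n + 2) → ℝ | (∀ i : Fin (n + 1), 0 < u (Fin.castSucc i)) ∧ ∑ i : Fin (n + 1), u (Fin.castSucc i) < 1 ∧ 0 < u (Fin.last (n + 1)) ∧ u (Fin.last (n + 1)) * (1 - ∑ i : Fin (n + 1), u (Fin.castSucc i)) < 1 ∧ ∀ i : Fin (n + 1), u (Fin.last (n + 1)) * u (Fin.castSucc i) < 1} ∧ 0 < w (Fin.last (n + 2)) ∧ w (Fin.last (n + 2)) < 1}, |d w| ≤ C) ∧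
      ∀ w ∈ {w : Fin (n + 3) → ℝ | (Fin.init w : Fin (n + 2) → ℝ) ∈ {u : Fin (n + 2) → ℝ | (∀ i : Fin (n + 1), 0 < u (Fin.castSucc i)) ∧ ∑ i : Fin (n + 1), u (Fin.castSucc i) < 1 ∧ 0 < u (Fin.last (n + 1)) ∧ u (Fin.last (n + 1)) * (1 - ∑ i : Fin (n + 1), u (Fin.castSucc i)) < 1 ∧ ∀ i : Fin (n + 1), u (Fin.last (n + 1)) * u (Fin.castSucc i) < 1} ∧ 0 < w (Fin.last (n + 2)) ∧ w (Fin.last (n + 2)) < 1},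
        HasDerivAt (fun a => Vy (Function.update w (Fin.castSucc (Fin.last (n + 1)) : Fin (n + 3)) a)) (d w) (w (Fin.castSucc (Fin.last (n + 1)) : Fin (n + 3))) := by
  intro n x s hx hs Θ T Z S H K M P hΘ0 hΘs hT hZ hS hH hK hM hP Vy hVy
  have hxR : (2:ℝ) ≤ x := by exact_mod_cast hx
  have hsR : (3:ℝ) ≤ s := by exact_mod_cast hs
  -- `Θ` depends on the angles only: it is constant along the `y`-slices, and `T_k = 1 − aΘ_k`
  have hΘinv : ∀ (u : Fin (n + 2) → ℝ) (a : ℝ) (k : Fin (n + 2)),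
      Θ (Function.update u (Fin.last (n + 1)) a) k = Θ u k := by
    intro u a k
    refine Fin.cases ?_ (fun i => ?_) k
    · rw [hΘ0, hΘ0]
      simp only [Function.update_of_ne (Fin.castSucc_lt_last _).ne]
    · rw [hΘs, hΘs, Function.update_of_ne (Fin.castSucc_lt_last _).ne]
  have hTsl : ∀ (u : Fin (n + 2) → ℝ) (a : ℝ) (k : Fin (n + 2)),
      T (Function.update u (Fin.last (n + 1)) a) k = 1 - a * Θ u k := by
    intro u a k
    rw [hT, Function.update_self, hΘinv]
  -- pointwise on `W`: the fibre derivative and its uniform bound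
  have key : ∀ w ∈ {w : Fin (n + 3) → ℝ | (Fin.init w : Fin (n + 2) → ℝ) ∈ {u : Fin (n + 2) → ℝ | (∀ i : Fin (n + 1), 0 < u (Fin.castSucc i)) ∧ ∑ i : Fin (n + 1), u (Fin.castSucc i) < 1 ∧ 0 < u (Fin.last (n + 1)) ∧ u (Fin.last (n + 1)) * (1 - ∑ i : Fin (n + 1), u (Fin.castSucc i)) < 1 ∧ ∀ i : Fin (n + 1), u (Fin.last (n + 1)) * u (Fin.castSucc i) < 1} ∧ 0 < w (Fin.last (n + 2)) ∧ w (Fin.last (n + 2)) < 1},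
      ∃ D, HasDerivAt (fun a => Vy (Function.update w (Fin.castSucc (Fin.last (n + 1)) : Fin (n + 3)) a)) D
          (w (Fin.castSucc (Fin.last (n + 1)) : Fin (n + 3))) ∧
        |D| ≤ (((n:ℝ) + 2) ^ 2) ^ (((n:ℝ) + 2) * (s:ℝ)) *
          ((((n:ℝ) + 2) * (s:ℝ) - 1) +
            ((n:ℝ) + 2) * (s:ℝ) * (((n:ℝ) + 2) ^ 3 * (1 + (2 * ((n:ℝ) + 2)) ^ (n + 3))) +
            ((n:ℝ) + 2) * (x:ℝ)) := by
    intro w hw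
    obtain ⟨hu, hv0, hv1⟩ := hw
    set u : Fin (n + 2) → ℝ := Fin.init w with hu_def
    have hmem := CornerGraphGen.T_mem hΘ0 hΘs hT hu
    have hsum := CornerGraphGen.sum_theta hΘ0 hΘs u
    have hprod := CornerGraphGen.prod_T_eq hT hS u
    have hinit : ∀ a, Fin.init (Function.update w (Fin.castSucc (Fin.last (n + 1))) a) =
        Function.update u (Fin.last (n + 1)) a := fun a => Fin.init_update_castSucc _ _ _
    have hlast : ∀ a, Function.update w (Fin.castSucc (Fin.last (n + 1))) a (Fin.last (n + 2)) =
        w (Fin.last (n + 2)) := fun a => Function.update_of_ne (Fin.castSucc_lt_last _).ne' _ _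
    refine CornerYDerivBound.fibre hxR hsR (θ := Θ u) (y := u (Fin.last (n + 1)))
      (v := w (Fin.last (n + 2))) (fun k => (hmem k).1.1) hsum hu.2.2.1 (fun k => (hmem k).1.2)
      hv0 hv1 (fun a => Z (Function.update u (Fin.last (n + 1)) a))
      (fun a => S (Function.update u (Fin.last (n + 1)) a))
      (fun a => Vy (Function.update w (Fin.castSucc (Fin.last (n + 1))) a))
      (fun k a => M (Function.update u (Fin.last (n + 1)) a) k)
      (fun a => ?_) (fun a => ?_) ?_ (fun k a => ?_) (fun a => ?_)
    · simp only [hZ, hTsl]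
    · simp only [hS, Function.update_self, hΘinv]
    · have h1 : ∏ k, (1 - u (Fin.last (n + 1)) * Θ u k) = ∏ k, T u k :=
        Finset.prod_congr rfl fun k _ => (hT u k).symm
      simp only [Function.update_eq_self]
      rw [h1, hprod]
      ring
    · simp only [hM, hTsl]
    · simp only [hVy, hP, hlast, hinit, hH, hK, hΘinv]
  choose! d hd using key
  exact ⟨d, ⟨_, fun w hw => (hd w hw).2⟩, fun w hw => (hd w hw).1⟩

end Summit.KontsevichZagierPeriods.TerasomaMultiplication.MultiplicationAccessible

end
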